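import Summits.ValiantsHypothesis.ValiantsHypothesis.Theorems.DefinabilityGapBlockMerging
import Summits.ValiantsHypothesis.ValiantsHypothesis.Theorems.DefinabilityGapSigmaPiSigmaTwo
import Summits.ValiantsHypothesis.ValiantsHypothesis.Theorems.DefinabilityGapQuadraticReading
import HarnessLib

/-!
# DefinabilityGap — THREE MATCHINGS: `G_m` hits `α₁Δ_{M₁} + α₂Δ_{M₂} + α₃Δ_{M₃}` (`m ≥ 6`)

Route `route-ValiantsHypothesis-DefinabilityGap` (decomp-valiant, lens 5: hardness–randomness / PIT axis); sequel of
`DefinabilityGapBlockMerging` (★ `kiPer_twoMerge_eq_zero`), with `DefinabilityGapSigmaPiSigmaTwo`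
(`kiPer_hits_sigmaPiSigmaTwo`), `DefinabilityGapSupportRung` (`kiPer_hits_support`) and `DefinabilityGapQuadraticReading`
(`kiPer_isHomogeneous`) BY NAME. `φ = bind₁ (kiPer m)`, `Δ_M = dprod M = ∏_{(u,v) ∈ M} (z_u − z_v)`.
ELEMENTARY · NEW-COMBINATION (claimed: variable-identification closure of the planted NW generator realised
seed-side; Dvir–Shpilka / Kayal–Saraf restrictions act on identities, here on f ≠ 0 after φ) · 0 S-currency ·
closes NO item · graphical forms z_a − z_b only; fan-in ≥ 4, general affine forms and the leaf regime w = q^b ≫ m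
NOT claimed · K1 / stmt-23704 / VP ≠ VNP untouched.

## ★ The theorem (`kiPer_hits_threeMatchings`)

For `m ≥ 6` and three ORIENTED MATCHINGS `M₁, M₂, M₃` of blocks (finite sets of pairs `(u, v)`, `u < v`
lexicographically — hypotheses `ho…` — with distinct pairs vertex-disjoint — hypotheses `hd…`; no predicate
is introduced, this file has 0 defs; sizes, supports and the blocks themselves arbitrary) and scalars
`α₁, α₂, α₃`: `f = α₁Δ_{M₁} + α₂Δ_{M₂} + α₃Δ_{M₃} ≠ 0 ⟹ f(G_m) ≠ 0`. No width, degree, size or read-once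
hypothesis enters. Proof (all steps kernel-checked below):
(i) some `α_j = 0`: two products of affine forms — `kiPer_hits_sigmaPiSigmaTwo` (`kiPer_hits_twoTerm`);
(ii) a size `|M_j|` different from the other two: the degree-`m|M_j|` homogeneous component of `φ f` is
`α_j φ(Δ_{M_j})`, and `φ(Δ_M) ≠ 0` (`coeff_eq_zero_of_card_ne`, `kiPer_dprod_ne_zero`);
(iii) two equal matchings: again two terms;
(iv) a CROSS PAIR — vertex-disjoint exclusive edges `e ∈ M_i ∖ M_k`, `e' ∈ M_j ∖ M_k`: the two-merge lemma kills
`α_k` (`coeff_eq_zero_of_cross`; orientation makes "exclusive" well defined);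
(v) no cross pair in any role: every exclusive edge of `M_i` meets a fixed exclusive edge of `M_j`, so
`|M_i ∖ M_k| ≤ 2` (`card_le_two_of_meet`); factor the common core `K = M₁ ∩ M₂ ∩ M₃`, `f = Δ_K · f̂` with
`φ(Δ_K) ≠ 0` and `f̂` supported on `≤ 16` blocks, `2·15 < 36 ≤ m²`: `kiPer_hits_support`.

## Non-vacuity (K6) and the majority ideal

Members: on `2n` blocks `c_1, …, c_{2n}` (`n ≥ 2`), `M₁ = {(c_{2i−1}, c_{2i})}`, `M₂ = {(c_{2i}, c_{2i+1})} ∪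
{(c_{2n}, c_1)}`, `M₃ = {(c_{4i−3}, c_{4i−1}), (c_{4i−2}, c_{4i})}` (oriented along any lexicographic labelling):
`f` has degree `n` and a read-once shape (ROABP width `≤ 10` in the block order), and for
`n ≥ ⌈m/2⌉` it lies in the MAJORITY IDEAL `I_{⌈m/2⌉−1}` — `dprod_restrict_eq_zero`: a matching product
restricted to `< |M|` free blocks, all other blocks frozen to one base value, is `0` (some edge has both ends
frozen). These sums are therefore invisible to every restriction road of the lineage (support `< m²/2`, free
axes, skeleton / corank flags), and (ii)–(v) settle them. SHARPNESS of the method: `m = 2` merges fail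
(`DefinabilityGapBlockMerging`, §2).

## HONEST BOUNDARY

Decided here: fan-in-3 sums of GRAPHICAL matching products, `m ≥ 6`, inside the majority-ideal residual.
NOT claimed: fan-in ≥ 4 (patch budget `≈ 3^{k−1}` per merge chain and a `K₄`-type combinatorial lemma would be
needed), general affine forms (no seed-side merge), the leaf regime w = q^b ≫ m of `KIPlantedHittingRO`;
0 S-currency; closes NO item; K1 / stmt-23704 / VP ≠ VNP untouched.
-/

noncomputable section

open MvPolynomial
open Literature.Computability.AlgebraicComplexity Literature.Computability.MetaComplexity
open Summit.ValiantsHypothesis.ValiantsHypothesis.Theorems.DefinabilityGapAffineRung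
open Summit.ValiantsHypothesis.ValiantsHypothesis.Theorems.DefinabilityGapSupportRung
open Summit.ValiantsHypothesis.ValiantsHypothesis.Theorems.DefinabilityGapSigmaPiSigmaTwo
open Summit.ValiantsHypothesis.ValiantsHypothesis.Theorems.DefinabilityGapBlockMerging

set_option linter.dupNamespace false

namespace Summit.ValiantsHypothesis.ValiantsHypothesis.Theorems.DefinabilityGapThreeMatchings

variable {m : ℕ}

/-! ## 1. Oriented matchings; `φ(Δ_M)` is nonzero and homogeneous -/

/-- ORIENTED MATCHINGS of blocks are finite sets of pairs `(u, v)` with `u < v` in the lexicographic order of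
`Fin 3 → 𝔽_q` (hypotheses `ho…`: no loops, ONE orientation per edge — reorienting an edge only flips the sign of
`Δ_M`, so this is no loss of generality), distinct pairs vertex-disjoint (hypotheses `hd…`). Oriented edges are
not loops. [this file] -/
theorem loopless_of_oriented {M : Finset ((Fin 3 → Fin (qOf m)) × (Fin 3 → Fin (qOf m)))}
    (ho : ∀ e ∈ M, toLex e.1 < toLex e.2) : ∀ e ∈ M, e.1 ≠ e.2 :=
  fun e he h => (ho e he).ne (congrArg toLex h)

/-- The reverse of an oriented edge lies in no oriented edge set. [this file] -/
theorem not_mem_swap_of_oriented {M M' : Finset ((Fin 3 → Fin (qOf m)) × (Fin 3 → Fin (qOf m)))}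
    (ho : ∀ e ∈ M, toLex e.1 < toLex e.2) (ho' : ∀ e ∈ M', toLex e.1 < toLex e.2) {u v : Fin 3 → Fin (qOf m)}
    (h : (u, v) ∈ M) : (v, u) ∉ M' :=
  fun h' => lt_asymm (ho _ h) (ho' _ h')

/-- `φ(Δ_N) ≠ 0` for every loopless edge set: `P_u ≠ P_v` for `u ≠ v` (`kiPer_linearIndependent`, `m ≥ 3`) and
`ℂ[y]` is a domain. [this file] -/
theorem kiPer_dprod_ne_zero (hm : 3 ≤ m) {N : Finset ((Fin 3 → Fin (qOf m)) × (Fin 3 → Fin (qOf m)))}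
    (hN : ∀ e ∈ N, e.1 ≠ e.2) : bind₁ (kiPer m) (dprod N) ≠ 0 := by
  rw [bind₁_dprod, Finset.prod_ne_zero_iff]
  exact fun e he => sub_ne_zero.2 ((kiPer_linearIndependent hm).injective.ne (hN e he))

/-- `φ(Δ_N)` is homogeneous of degree `|N|·m` (`kiPer_isHomogeneous`). [this file] -/
theorem isHomogeneous_kiPer_dprod (N : Finset ((Fin 3 → Fin (qOf m)) × (Fin 3 → Fin (qOf m)))) :
    (bind₁ (kiPer m) (dprod N)).IsHomogeneous (N.card * m) := by
  have h : (∏ e ∈ N, (kiPer m e.1 - kiPer m e.2)).IsHomogeneous (∑ _e ∈ N, m) :=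
    IsHomogeneous.prod N (fun e => kiPer m e.1 - kiPer m e.2) (fun _ => m)
      fun e _ => (kiPer_isHomogeneous e.1).sub (kiPer_isHomogeneous e.2)
  rw [Finset.sum_const, smul_eq_mul] at h; rw [bind₁_dprod]; exact h

/-! ## 2. Two terms, degree separation, cross pairs -/

/-- (i) Two difference products: `φ(βΔ_M + β'Δ_{M'}) ≠ 0` whenever `βΔ_M + β'Δ_{M'} ≠ 0` — the tree's ΣΠΣ(2) theorem
`kiPer_hits_sigmaPiSigmaTwo`, repackaged for `dprod`. [this file] -/
theorem kiPer_hits_twoTerm (hm : 3 ≤ m) (M M' : Finset ((Fin 3 → Fin (qOf m)) × (Fin 3 → Fin (qOf m))))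
    (β β' : ℂ) (h : C β * dprod M + C β' * dprod M' ≠ 0) :
    bind₁ (kiPer m) (C β * dprod M + C β' * dprod M') ≠ 0 := by
  have key : ∀ (N : Finset ((Fin 3 → Fin (qOf m)) × (Fin 3 → Fin (qOf m)))) (γ : ℂ),
      C γ * dprod N = (C γ ::ₘ N.val.map fun e => X e.1 - X e.2).prod ∧
        ∀ p ∈ (C γ ::ₘ N.val.map fun e => X e.1 - X e.2), p.totalDegree ≤ 1 := by
    intro N γ
    refine ⟨by rw [Multiset.prod_cons, dprod, Finset.prod_eq_multiset_prod], fun p hp => ?_⟩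
    rcases Multiset.mem_cons.1 hp with hp | hp
    · rw [hp, totalDegree_C]; exact Nat.zero_le 1
    · obtain ⟨e, _, rfl⟩ := Multiset.mem_map.1 hp
      show (X e.1 - X e.2 : MvPolynomial (Fin 3 → Fin (qOf m)) ℂ).totalDegree ≤ 1
      exact (totalDegree_sub _ _).trans (max_le (totalDegree_X _).le (totalDegree_X _).le)
  obtain ⟨e₁, d₁⟩ := key M β; obtain ⟨e₂, d₂⟩ := key M' β'
  rw [e₁, e₂] at h ⊢; exact kiPer_hits_sigmaPiSigmaTwo hm _ _ d₁ d₂ h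

/-- (ii) Degree separation: if `|N₃|` differs from `|N₁|` and `|N₂|` (loopless `N₃`), then
`φ(γ₁Δ_{N₁} + γ₂Δ_{N₂} + γ₃Δ_{N₃}) = 0` forces `γ₃ = 0` — read the degree-`m|N₃|` component. [this file] -/
theorem coeff_eq_zero_of_card_ne (hm : 3 ≤ m)
    {N₁ N₂ N₃ : Finset ((Fin 3 → Fin (qOf m)) × (Fin 3 → Fin (qOf m)))} (hN₃ : ∀ e ∈ N₃, e.1 ≠ e.2)
    (h₁ : N₃.card ≠ N₁.card) (h₂ : N₃.card ≠ N₂.card) {γ₁ γ₂ γ₃ : ℂ}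
    (h : bind₁ (kiPer m) (C γ₁ * dprod N₁ + C γ₂ * dprod N₂ + C γ₃ * dprod N₃) = 0) : γ₃ = 0 := by
  have hm0 : 0 < m := by omega
  have key : ∀ (N : Finset ((Fin 3 → Fin (qOf m)) × (Fin 3 → Fin (qOf m)))) (γ : ℂ),
      homogeneousComponent (N₃.card * m) (bind₁ (kiPer m) (C γ * dprod N)) =
        if N₃.card * m = N.card * m then C γ * bind₁ (kiPer m) (dprod N) else 0 := by
    intro N γ
    rw [map_mul, bind₁_C_right, homogeneousComponent_C_mul,
      homogeneousComponent_of_mem (isHomogeneous_kiPer_dprod N), mul_ite, mul_zero]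
  have hc := congrArg (homogeneousComponent (N₃.card * m)) h
  rw [map_add, map_add, map_add, map_add, map_zero, key, key, key,
    if_neg (fun e => h₁ (Nat.eq_of_mul_eq_mul_right hm0 e)),
    if_neg (fun e => h₂ (Nat.eq_of_mul_eq_mul_right hm0 e)), if_pos (rfl : N₃.card * m = N₃.card * m),
    zero_add, zero_add] at hc
  exact (mul_eq_zero.1 hc).elim (fun h' => C_eq_zero.1 h') fun h' => absurd h' (kiPer_dprod_ne_zero hm hN₃)

/-- (iv) A CROSS PAIR kills the third coefficient: exclusive edges `(a,b) ∈ M_i ∖ M_k`, `(x,y) ∈ M_j ∖ M_k` on four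
distinct blocks give `α_k = 0` — the two-merge lemma `kiPer_twoMerge_eq_zero` (orientation excludes the reversed
edges from `M_k`). [this file] -/
theorem coeff_eq_zero_of_cross (hm : 5 ≤ m) {Mi Mj Mk : Finset ((Fin 3 → Fin (qOf m)) × (Fin 3 → Fin (qOf m)))}
    (hoi : ∀ e ∈ Mi, toLex e.1 < toLex e.2) (hoj : ∀ e ∈ Mj, toLex e.1 < toLex e.2)
    (hok : ∀ e ∈ Mk, toLex e.1 < toLex e.2) {a b x y : Fin 3 → Fin (qOf m)}
    (he : (a, b) ∈ Mi) (hek : (a, b) ∉ Mk) (he' : (x, y) ∈ Mj) (hek' : (x, y) ∉ Mk)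
    (hd : a ≠ x ∧ a ≠ y ∧ b ≠ x ∧ b ≠ y) {γi γj γk : ℂ}
    (h : bind₁ (kiPer m) (C γi * dprod Mi + C γj * dprod Mj + C γk * dprod Mk) = 0) : γk = 0 :=
  kiPer_twoMerge_eq_zero hm (loopless_of_oriented hoi _ he) hd.1.symm hd.2.2.1.symm hd.2.1.symm hd.2.2.2.symm
    (loopless_of_oriented hoj _ he') he he' (fun e he'' => ⟨loopless_of_oriented hok e he'',
      fun hq => hek (hq ▸ he''), fun hq => not_mem_swap_of_oriented hoi hok he (hq ▸ he''),
      fun hq => hek' (hq ▸ he''), fun hq => not_mem_swap_of_oriented hoj hok he' (hq ▸ he'')⟩) h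

/-! ## 3. No cross pair: at most two exclusive edges -/

/-- (v) If every edge of a matching `A` meets the fixed pair `{x, y}`, then `|A| ≤ 2`: `e ↦` (its vertex among
`x, y`, preferring `x`) injects `A` into `{x, y}`. [this file] -/
theorem card_le_two_of_meet {A : Finset ((Fin 3 → Fin (qOf m)) × (Fin 3 → Fin (qOf m)))}
    (hA : ∀ e ∈ A, ∀ e' ∈ A, e ≠ e' → e.1 ≠ e'.1 ∧ e.1 ≠ e'.2 ∧ e.2 ≠ e'.1 ∧ e.2 ≠ e'.2)
    (x y : Fin 3 → Fin (qOf m)) (hmeet : ∀ e ∈ A, ¬(e.1 ≠ x ∧ e.1 ≠ y ∧ e.2 ≠ x ∧ e.2 ≠ y)) :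
    A.card ≤ 2 := by
  have hxy : ∀ e ∈ A, ¬(e.1 = x ∨ e.2 = x) → e.1 = y ∨ e.2 = y := fun e he hx => by
    by_contra hy
    exact hmeet e he ⟨fun h => hx (Or.inl h), fun h => hy (Or.inl h), fun h => hx (Or.inr h),
      fun h => hy (Or.inr h)⟩
  refine (Finset.card_le_card_of_injOn (s := A) (t := {x, y}) (fun e => if e.1 = x ∨ e.2 = x then x else y)
    (fun e _ => ?_) ?_).trans Finset.card_le_two
  · show (if e.1 = x ∨ e.2 = x then x else y) ∈ (({x, y} : Finset (Fin 3 → Fin (qOf m))) : Set _)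
    rw [Finset.mem_coe]; split_ifs
    · exact Finset.mem_insert_self _ _
    · exact Finset.mem_insert_of_mem (Finset.mem_singleton_self _)
  · intro e he e' he' hge
    have hge' : (if e.1 = x ∨ e.2 = x then x else y) = (if e'.1 = x ∨ e'.2 = x then x else y) := hge
    by_contra hne
    obtain ⟨h11, h12, h21, h22⟩ := hA e he e' he' hne
    by_cases hx : e.1 = x ∨ e.2 = x <;> by_cases hx' : e'.1 = x ∨ e'.2 = x
    · rcases hx with h | h <;> rcases hx' with h' | h'
      exacts [h11 (h.trans h'.symm), h12 (h.trans h'.symm), h21 (h.trans h'.symm), h22 (h.trans h'.symm)]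
    · rw [if_pos hx, if_neg hx'] at hge'
      rcases hxy e' he' hx' with h' | h'
      exacts [hx' (Or.inl (h'.trans hge'.symm)), hx' (Or.inr (h'.trans hge'.symm))]
    · rw [if_neg hx, if_pos hx'] at hge'
      rcases hxy e he hx with h | h
      exacts [hx (Or.inl (h.trans hge')), hx (Or.inr (h.trans hge'))]
    · rcases hxy e he hx with h | h <;> rcases hxy e' he' hx' with h' | h'
      exacts [h11 (h.trans h'.symm), h12 (h.trans h'.symm), h21 (h.trans h'.symm), h22 (h.trans h'.symm)]

/-- Two distinct finite sets of the same size have a nonempty difference. [this file] -/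
theorem sdiff_nonempty_of_ne {s t : Finset ((Fin 3 → Fin (qOf m)) × (Fin 3 → Fin (qOf m)))} (hne : s ≠ t)
    (hcard : t.card ≤ s.card) : (s \ t).Nonempty := by
  rw [Finset.nonempty_iff_ne_empty, Ne, Finset.sdiff_eq_empty_iff_subset]
  exact fun hsub => hne (Finset.eq_of_subset_of_card_le hsub hcard)

/-- A block occurring in `Δ_N` is an endpoint of an edge of `N` (induction on `N`: `Finset.prod_insert`,
`vars_mul`, `vars_X`; the generic `vars_prod` is avoided — it unifies slowly with `dprod`). [this file] -/
theorem mem_vars_dprod {N : Finset ((Fin 3 → Fin (qOf m)) × (Fin 3 → Fin (qOf m)))} {v : Fin 3 → Fin (qOf m)} :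
    v ∈ (dprod N).vars → ∃ e ∈ N, v = e.1 ∨ v = e.2 := by
  refine Finset.induction_on N (fun hv => ?_) fun e N' heN ih hv => ?_
  · unfold dprod at hv; rw [Finset.prod_empty, vars_one] at hv
    exact absurd hv (Finset.notMem_empty v)
  · unfold dprod at hv; rw [Finset.prod_insert heN] at hv
    rcases Finset.mem_union.1 (vars_mul _ _ hv) with h | h
    · have h' := (vars_sub_subset (p := X e.1) (q := X e.2)) h
      rw [vars_X, vars_X, Finset.mem_union, Finset.mem_singleton, Finset.mem_singleton] at h'
      exact ⟨e, Finset.mem_insert_self e N', h'⟩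
    · obtain ⟨e', he', h'⟩ := ih h
      exact ⟨e', Finset.mem_insert_of_mem he', h'⟩

/-- The blocks of `γ·Δ_N` lie among the endpoints of any edge set containing `N`. [this file] -/
theorem vars_C_mul_dprod_subset (γ : ℂ) {N D : Finset ((Fin 3 → Fin (qOf m)) × (Fin 3 → Fin (qOf m)))}
    (h : N ⊆ D) : (C γ * dprod N).vars ⊆ D.biUnion fun e => ({e.1, e.2} : Finset (Fin 3 → Fin (qOf m))) := by
  intro v hv
  have hv' := vars_mul (C γ) (dprod N) hv
  rw [vars_C, Finset.empty_union] at hv'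
  obtain ⟨e, he, hve⟩ := mem_vars_dprod hv'
  refine Finset.mem_biUnion.2 ⟨e, h he, ?_⟩
  rw [Finset.mem_insert, Finset.mem_singleton]; exact hve

/-! ## 4. ★ The three-matching theorem -/

/-- ★ **`G_m` hits three matchings** (`m ≥ 6`, KERNEL, unconditional): for oriented matchings `M₁, M₂, M₃` of
blocks (`ho_j`: edges `u < v` lexicographically; `hd_j`: distinct edges vertex-disjoint) and scalars `α₁, α₂, α₃`,
if `f = α₁Δ_{M₁} + α₂Δ_{M₂} + α₃Δ_{M₃} ≠ 0` then `f(G_m) ≠ 0` — no width, degree or size hypothesis.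
ELEMENTARY · NEW-COMBINATION · 0 S-currency · closes NO item; settles the three-matching sums inside the
majority-ideal residual; fan-in ≥ 4 / affine / leaf regime NOT claimed. [this file] -/
theorem kiPer_hits_threeMatchings (hm : 6 ≤ m)
    {M₁ M₂ M₃ : Finset ((Fin 3 → Fin (qOf m)) × (Fin 3 → Fin (qOf m)))}
    (ho₁ : ∀ e ∈ M₁, toLex e.1 < toLex e.2) (ho₂ : ∀ e ∈ M₂, toLex e.1 < toLex e.2)
    (ho₃ : ∀ e ∈ M₃, toLex e.1 < toLex e.2)
    (hd₁ : ∀ e ∈ M₁, ∀ e' ∈ M₁, e ≠ e' → e.1 ≠ e'.1 ∧ e.1 ≠ e'.2 ∧ e.2 ≠ e'.1 ∧ e.2 ≠ e'.2)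
    (hd₂ : ∀ e ∈ M₂, ∀ e' ∈ M₂, e ≠ e' → e.1 ≠ e'.1 ∧ e.1 ≠ e'.2 ∧ e.2 ≠ e'.1 ∧ e.2 ≠ e'.2)
    (hd₃ : ∀ e ∈ M₃, ∀ e' ∈ M₃, e ≠ e' → e.1 ≠ e'.1 ∧ e.1 ≠ e'.2 ∧ e.2 ≠ e'.1 ∧ e.2 ≠ e'.2) {α₁ α₂ α₃ : ℂ}
    (hf : C α₁ * dprod M₁ + C α₂ * dprod M₂ + C α₃ * dprod M₃ ≠ 0) :
    bind₁ (kiPer m) (C α₁ * dprod M₁ + C α₂ * dprod M₂ + C α₃ * dprod M₃) ≠ 0 := by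
  intro h0
  have hm3 : 3 ≤ m := by omega
  have hm5 : 5 ≤ m := by omega
  -- (i) all three coefficients are nonzero
  have hα₃ : α₃ ≠ 0 := by
    rintro rfl; rw [C_0, zero_mul, add_zero] at hf h0
    exact kiPer_hits_twoTerm hm3 M₁ M₂ α₁ α₂ hf h0
  have hα₁ : α₁ ≠ 0 := by
    rintro rfl; rw [C_0, zero_mul, zero_add] at hf h0
    exact kiPer_hits_twoTerm hm3 M₂ M₃ α₂ α₃ hf h0
  have hα₂ : α₂ ≠ 0 := by
    rintro rfl; rw [C_0, zero_mul, add_zero] at hf h0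
    exact kiPer_hits_twoTerm hm3 M₁ M₃ α₁ α₃ hf h0
  -- the two rotations of the sum (`add_rotate a b c : a + b + c = b + c + a`)
  have h0' : bind₁ (kiPer m) (C α₂ * dprod M₂ + C α₃ * dprod M₃ + C α₁ * dprod M₁) = 0 := by
    rw [← add_rotate]; exact h0
  have h0'' : bind₁ (kiPer m) (C α₃ * dprod M₃ + C α₁ * dprod M₁ + C α₂ * dprod M₂) = 0 := by
    rw [add_rotate]; exact h0
  -- (ii) the three sizes agree
  have hsz : M₁.card = M₂.card ∧ M₂.card = M₃.card := by
    by_cases e12 : M₁.card = M₂.card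
    · by_cases e23 : M₂.card = M₃.card
      · exact ⟨e12, e23⟩
      · exact absurd (coeff_eq_zero_of_card_ne hm3 (loopless_of_oriented ho₃) (by omega) (by omega) h0) hα₃
    · by_cases e13 : M₁.card = M₃.card
      · exact absurd (coeff_eq_zero_of_card_ne hm3 (loopless_of_oriented ho₂) (by omega) (by omega) h0'') hα₂
      · exact absurd (coeff_eq_zero_of_card_ne hm3 (loopless_of_oriented ho₁) (by omega) (by omega) h0') hα₁
  obtain ⟨e12, e23⟩ := hsz
  -- (iii) the three matchings are pairwise distinct
  by_cases q12 : M₁ = M₂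
  · rw [← q12] at hf h0
    have e : C α₁ * dprod M₁ + C α₂ * dprod M₁ + C α₃ * dprod M₃ =
        C (α₁ + α₂) * dprod M₁ + C α₃ * dprod M₃ := by rw [C_add, add_mul]
    rw [e] at hf h0; exact kiPer_hits_twoTerm hm3 M₁ M₃ (α₁ + α₂) α₃ hf h0
  by_cases q13 : M₁ = M₃
  · rw [← q13] at hf h0
    have e : C α₁ * dprod M₁ + C α₂ * dprod M₂ + C α₃ * dprod M₁ =
        C (α₁ + α₃) * dprod M₁ + C α₂ * dprod M₂ := by rw [C_add, add_mul, add_right_comm]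
    rw [e] at hf h0; exact kiPer_hits_twoTerm hm3 M₁ M₂ (α₁ + α₃) α₂ hf h0
  by_cases q23 : M₂ = M₃
  · rw [← q23] at hf h0
    have e : C α₁ * dprod M₁ + C α₂ * dprod M₂ + C α₃ * dprod M₂ =
        C α₁ * dprod M₁ + C (α₂ + α₃) * dprod M₂ := by rw [C_add, add_mul, add_assoc]
    rw [e] at hf h0; exact kiPer_hits_twoTerm hm3 M₁ M₂ α₁ (α₂ + α₃) hf h0
  -- (iv) a cross pair in some role kills a nonzero coefficient
  by_cases x₃ : ∃ e ∈ M₁ \ M₃, ∃ e' ∈ M₂ \ M₃, e.1 ≠ e'.1 ∧ e.1 ≠ e'.2 ∧ e.2 ≠ e'.1 ∧ e.2 ≠ e'.2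
  · obtain ⟨⟨a, b⟩, he, ⟨x, y⟩, he', hd⟩ := x₃; rw [Finset.mem_sdiff] at he he'
    exact hα₃ (coeff_eq_zero_of_cross hm5 ho₁ ho₂ ho₃ he.1 he.2 he'.1 he'.2 hd h0)
  by_cases x₁ : ∃ e ∈ M₂ \ M₁, ∃ e' ∈ M₃ \ M₁, e.1 ≠ e'.1 ∧ e.1 ≠ e'.2 ∧ e.2 ≠ e'.1 ∧ e.2 ≠ e'.2
  · obtain ⟨⟨a, b⟩, he, ⟨x, y⟩, he', hd⟩ := x₁; rw [Finset.mem_sdiff] at he he'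
    exact hα₁ (coeff_eq_zero_of_cross hm5 ho₂ ho₃ ho₁ he.1 he.2 he'.1 he'.2 hd h0')
  by_cases x₂ : ∃ e ∈ M₃ \ M₂, ∃ e' ∈ M₁ \ M₂, e.1 ≠ e'.1 ∧ e.1 ≠ e'.2 ∧ e.2 ≠ e'.1 ∧ e.2 ≠ e'.2
  · obtain ⟨⟨a, b⟩, he, ⟨x, y⟩, he', hd⟩ := x₂; rw [Finset.mem_sdiff] at he he'
    exact hα₂ (coeff_eq_zero_of_cross hm5 ho₃ ho₁ ho₂ he.1 he.2 he'.1 he'.2 hd h0'')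
  -- (v) no cross pair: every difference `M_i ∖ M_k` has at most two edges
  have sub : ∀ {s t : Finset ((Fin 3 → Fin (qOf m)) × (Fin 3 → Fin (qOf m)))},
      (∀ e ∈ s, ∀ e' ∈ s, e ≠ e' → e.1 ≠ e'.1 ∧ e.1 ≠ e'.2 ∧ e.2 ≠ e'.1 ∧ e.2 ≠ e'.2) →
      ∀ e ∈ s \ t, ∀ e' ∈ s \ t, e ≠ e' → e.1 ≠ e'.1 ∧ e.1 ≠ e'.2 ∧ e.2 ≠ e'.1 ∧ e.2 ≠ e'.2 :=
    fun hs e he e' he' hne => hs e (Finset.mem_sdiff.1 he).1 e' (Finset.mem_sdiff.1 he').1 hne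
  obtain ⟨u, hu⟩ := sdiff_nonempty_of_ne (fun h => q23 h.symm) e23.le
  obtain ⟨v, hv⟩ := sdiff_nonempty_of_ne q23 e23.symm.le
  obtain ⟨w, hw⟩ := sdiff_nonempty_of_ne (fun h => q13 h.symm) (e12.trans e23).le
  obtain ⟨z, hz⟩ := sdiff_nonempty_of_ne (fun h => q12 h.symm) e12.le
  have b₁₂ : (M₁ \ M₂).card ≤ 2 := card_le_two_of_meet (sub hd₁) u.1 u.2 fun e' he' hd =>
    x₂ ⟨u, hu, e', he', ⟨hd.1.symm, hd.2.2.1.symm, hd.2.1.symm, hd.2.2.2.symm⟩⟩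
  have b₁₃ : (M₁ \ M₃).card ≤ 2 := card_le_two_of_meet (sub hd₁) v.1 v.2 fun e he hd => x₃ ⟨e, he, v, hv, hd⟩
  have b₂₁ : (M₂ \ M₁).card ≤ 2 := card_le_two_of_meet (sub hd₂) w.1 w.2 fun e he hd => x₁ ⟨e, he, w, hw, hd⟩
  have b₃₁ : (M₃ \ M₁).card ≤ 2 := card_le_two_of_meet (sub hd₃) z.1 z.2 fun e' he' hd =>
    x₁ ⟨z, hz, e', he', ⟨hd.1.symm, hd.2.2.1.symm, hd.2.1.symm, hd.2.2.2.symm⟩⟩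
  -- the exclusive edges `D` and the common core `K`
  obtain ⟨D, hD⟩ : ∃ D, D = (M₁ \ M₂) ∪ (M₁ \ M₃) ∪ (M₂ \ M₁) ∪ (M₃ \ M₁) := ⟨_, rfl⟩
  have hDc : D.card ≤ 8 := by
    have u₁ := Finset.card_union_le (M₁ \ M₂) (M₁ \ M₃)
    have u₂ := Finset.card_union_le ((M₁ \ M₂) ∪ (M₁ \ M₃)) (M₂ \ M₁)
    have u₃ := Finset.card_union_le ((M₁ \ M₂) ∪ (M₁ \ M₃) ∪ (M₂ \ M₁)) (M₃ \ M₁)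
    rw [hD]; omega
  have hDm : ∀ e, (e ∈ M₁ ∧ e ∉ M₂) ∨ (e ∈ M₁ ∧ e ∉ M₃) ∨ (e ∈ M₂ ∧ e ∉ M₁) ∨ (e ∈ M₃ ∧ e ∉ M₁) →
      e ∈ D := by
    intro e he
    rw [hD, Finset.mem_union, Finset.mem_union, Finset.mem_union, Finset.mem_sdiff, Finset.mem_sdiff,
      Finset.mem_sdiff, Finset.mem_sdiff]
    rcases he with h | h | h | h
    exacts [Or.inl (Or.inl (Or.inl h)), Or.inl (Or.inl (Or.inr h)), Or.inl (Or.inr h), Or.inr h]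
  obtain ⟨K, hK⟩ : ∃ K, K = M₁ ∩ M₂ ∩ M₃ := ⟨_, rfl⟩
  have hKm : ∀ e, e ∈ K ↔ (e ∈ M₁ ∧ e ∈ M₂) ∧ e ∈ M₃ := fun e => by rw [hK, Finset.mem_inter, Finset.mem_inter]
  have hK₁ : K ⊆ M₁ := fun e he => ((hKm e).1 he).1.1
  have hK₂ : K ⊆ M₂ := fun e he => ((hKm e).1 he).1.2
  have hK₃ : K ⊆ M₃ := fun e he => ((hKm e).1 he).2
  have p₁ : M₁ \ K ⊆ D := fun e he => by
    rw [Finset.mem_sdiff, hKm] at he; by_cases h2 : e ∈ M₂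
    · exact hDm e (Or.inr (Or.inl ⟨he.1, fun h3 => he.2 ⟨⟨he.1, h2⟩, h3⟩⟩))
    · exact hDm e (Or.inl ⟨he.1, h2⟩)
  have p₂ : M₂ \ K ⊆ D := fun e he => by
    rw [Finset.mem_sdiff, hKm] at he; by_cases h1 : e ∈ M₁
    · exact hDm e (Or.inr (Or.inl ⟨h1, fun h3 => he.2 ⟨⟨h1, he.1⟩, h3⟩⟩))
    · exact hDm e (Or.inr (Or.inr (Or.inl ⟨he.1, h1⟩)))
  have p₃ : M₃ \ K ⊆ D := fun e he => by
    rw [Finset.mem_sdiff, hKm] at he; by_cases h1 : e ∈ M₁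
    · exact hDm e (Or.inl ⟨h1, fun h2 => he.2 ⟨⟨h1, h2⟩, he.1⟩⟩)
    · exact hDm e (Or.inr (Or.inr (Or.inr ⟨he.1, h1⟩)))
  have fac : ∀ {M : Finset ((Fin 3 → Fin (qOf m)) × (Fin 3 → Fin (qOf m)))}, K ⊆ M →
      dprod M = dprod (M \ K) * dprod K := by
    intro M hKM; unfold dprod; rw [Finset.prod_sdiff hKM]
  have hf' : C α₁ * dprod M₁ + C α₂ * dprod M₂ + C α₃ * dprod M₃ =
      (C α₁ * dprod (M₁ \ K) + C α₂ * dprod (M₂ \ K) + C α₃ * dprod (M₃ \ K)) * dprod K := by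
    rw [fac hK₁, fac hK₂, fac hK₃, add_mul, add_mul, mul_assoc, mul_assoc, mul_assoc]
  rw [hf'] at hf h0; rw [map_mul] at h0
  have hK0 : bind₁ (kiPer m) (dprod K) ≠ 0 :=
    kiPer_dprod_ne_zero hm3 fun e he => loopless_of_oriented ho₁ e (hK₁ he)
  have hg : C α₁ * dprod (M₁ \ K) + C α₂ * dprod (M₂ \ K) + C α₃ * dprod (M₃ \ K) ≠ 0 :=
    fun h => hf (by rw [h, zero_mul])
  refine kiPer_hits_support m hg ?_ ((mul_eq_zero.1 h0).resolve_right hK0)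
  -- `f̂` lives on the `≤ 16` endpoints of `D`, and `2 · 15 < 36 ≤ m²`
  have hV : (C α₁ * dprod (M₁ \ K) + C α₂ * dprod (M₂ \ K) + C α₃ * dprod (M₃ \ K)).vars ⊆
      D.biUnion fun e => ({e.1, e.2} : Finset (Fin 3 → Fin (qOf m))) := by
    intro v hv
    rcases Finset.mem_union.1 (vars_add_subset _ _ hv) with hv | hv
    · rcases Finset.mem_union.1 (vars_add_subset _ _ hv) with hv | hv
      · exact vars_C_mul_dprod_subset α₁ p₁ hv
      · exact vars_C_mul_dprod_subset α₂ p₂ hv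
    · exact vars_C_mul_dprod_subset α₃ p₃ hv
  have hVc : (D.biUnion fun e => ({e.1, e.2} : Finset (Fin 3 → Fin (qOf m)))).card ≤ D.card • 2 :=
    Finset.card_biUnion_le.trans (Finset.sum_le_card_nsmul _ _ _ fun _ _ => Finset.card_le_two)
  rw [smul_eq_mul] at hVc
  have hc := Finset.card_le_card hV; have h36 : 6 * 6 ≤ m * m := Nat.mul_le_mul hm hm
  omega

/-! ## 5. The member family lies in the majority ideal (K6) -/

/-- MAJORITY-IDEAL MEMBERSHIP (K6 non-vacuity, kernel form): a matching product `Δ_M` restricted to fewer than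
`|M|` free blocks `S` — every other block frozen to one base value `t` — is `0`: some edge of `M` has both
endpoints frozen (else "an endpoint in `S`" injects `M` into `S`). Hence the three-matching sums with
`|M_j| = n ≥ ⌈m/2⌉` vanish under every restriction to `≤ ⌈m/2⌉ − 1` free blocks. [this file] -/
theorem dprod_restrict_eq_zero {M : Finset ((Fin 3 → Fin (qOf m)) × (Fin 3 → Fin (qOf m)))}
    (hd : ∀ e ∈ M, ∀ e' ∈ M, e ≠ e' → e.1 ≠ e'.1 ∧ e.1 ≠ e'.2 ∧ e.2 ≠ e'.1 ∧ e.2 ≠ e'.2)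
    (S : Finset (Fin 3 → Fin (qOf m))) (hS : S.card < M.card) (t : ℂ) :
    bind₁ (fun c => if c ∈ S then (X c : MvPolynomial (Fin 3 → Fin (qOf m)) ℂ) else C t) (dprod M) = 0 := by
  by_contra hne
  have hmeet : ∀ e ∈ M, e.1 ∈ S ∨ e.2 ∈ S := by
    intro e he; by_contra hout; refine hne ?_
    rw [dprod, map_prod]
    refine Finset.prod_eq_zero he ?_
    rw [map_sub, bind₁_X_right, bind₁_X_right]
    show (if e.1 ∈ S then X e.1 else C t) - (if e.2 ∈ S then X e.2 else C t) = 0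
    rw [if_neg (fun h => hout (Or.inl h)), if_neg (fun h => hout (Or.inr h)), sub_self]
  refine absurd (Finset.card_le_card_of_injOn (s := M) (t := S) (fun e => if e.1 ∈ S then e.1 else e.2)
    (fun e he => ?_) ?_) (not_le.2 hS)
  · show (if e.1 ∈ S then e.1 else e.2) ∈ (S : Set (Fin 3 → Fin (qOf m)))
    rw [Finset.mem_coe]; split_ifs with h
    · exact h
    · exact (hmeet e he).resolve_left h
  · intro e he e' he' hge
    have hge' : (if e.1 ∈ S then e.1 else e.2) = (if e'.1 ∈ S then e'.1 else e'.2) := hge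
    by_contra hne'
    obtain ⟨h11, h12, h21, h22⟩ := hd e he e' he' hne'
    by_cases h : e.1 ∈ S <;> by_cases h' : e'.1 ∈ S
    · rw [if_pos h, if_pos h'] at hge'; exact h11 hge'
    · rw [if_pos h, if_neg h'] at hge'; exact h12 hge'
    · rw [if_neg h, if_pos h'] at hge'; exact h21 hge'
    · rw [if_neg h, if_neg h'] at hge'; exact h22 hge'

end Summit.ValiantsHypothesis.ValiantsHypothesis.Theorems.DefinabilityGapThreeMatchings
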